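import Literature.MathematicalPhysics.QuantumFieldTheory.Balaban1983to89.B1Eq324BenfattoDisintegration
import HarnessLib

/-!
# `Balaban1983to89.B1Eq324BenfattoSect5Boxes` — [BenfattoEtAl1978] §5 «Proof of the Lemma», p. 154–155: the OBJECTS (5.5)–(5.10)
# (regions `H_R`, interactions `H_{R,S}`, the tesserae `□` of side `b²` with their corridors `Γ₁(□)`, `Γ₂(□)` and core `□′`, `Ψ_□`,
# `Ĥ_J`, `H^{(l)}`) TYPED AS PRINTED on the tree's carriers, with their structural lemmas and THE INSTANCE OF (5.13) ON PRINT'S BOXES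

statement-level skeleton of published theorems with citation tags; proofs where landed; nothing here is a claim about the
Yang–Mills mass gap

WHY THIS MODULE (cell `pub-ymgap`, seat `dag-n08-d` gen 8; node N08 [Balaban1985UV3]; in-edge SOURCE chain behind the (α)-row `h324c`:
[B10] (24)/(58) ← [B1] (3.24) ← [BenfattoEtAl1978] Lemma p. 152 = `B1Eq324BenfattoLemma.BasicLemmaPrinted`).  With App. A / App. C /
(C.2)–(C.8) / strict positivity / the Markov property / the conditional law all tree theorems (seats n08-b and n08-d, 2026-08-27), what is
left of the Basic Lemma is the BODY of its §5 proof.  Its first page fixes the objects; this file types them (desk ME #26 of record: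
renders `lit-balaban-typer/renders/benfatto1978-cmp59/bcg_p154_s3.png`, `bcg_p155_s3.png`, read first-hand).

THE PRINTED TEXT (pp. 154–155, verbatim from the page images).  *"Proof of the Lemma. Throughout the proof C, I, and J are fixed. Let R
be a region paved by Q₀ and let H_R = Σ_{p=1}^{S} Σ_{Δ_i∈Q₀, Δ_i⊂R, i:1…p} Σ_{n_i>0, Σ_in_i≦D, i:1…p} A^{n₁…n_p}_{Δ₁…Δ_p}
e^{−(ϰ/2)d(Δ₁…Δ_p)} z^{n₁}_{Δ₁}…z^{n_p}_{Δ_p} (5.5) where the definitions of the A's is extended so that A^{n₁…n_p}_{Δ₁…Δ_p} = 0 if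
some Δ_i ⊄ J, i = 1,…,p. Given two different regions R and S (paved by Q₀) we define the interaction between R and S as H_{R,S} =
H_{R∪S} − H_R − H_S. (5.6) We consider tesserae □ paved by Q₀ of side b² (for simplicity we assume b^{1/2}/4 integer …). Let Q^b be
the corresponding pavement made up by the tesserae □. For any □ ∈ Q^b we put □ = □′ ∪ Γ₂(□) ∪ Γ₁(□) (5.7) where Γ₂(□) and Γ₁(□) are
corridors of width b^{3/2}, Γ₁(□) is adjacent to the boundary of □ and Γ₂(□) is adjacent to the internal boundary of Γ₁(□) (see
Fig. 1)."*  p. 155: *"We define Γ₁ = ⋃_{□∈Q^b} Γ₁(□) (5.8) and we have H_J = H_{Γ₁} + Σ_{□: □∩J≠∅} Ψ_□ + H^{(l)} ≡ Ĥ_J + H^{(l)} (5.9)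
Ψ_□ = H_{□′∪Γ₂(□)} + H_{Γ₂(□),Γ₁(□)} (5.10) where H^{(l)} = H_J − Ĥ_J can be bounded as [see (4.5)] |H^{(l)} Π_Δ χ̂_Δ| ≦
s₁Ab^De^{−(ϰ/4)b^{3/2}}|I|. (5.11) Therefore the main point is to estimate ∫ P̄(dz) Π_Δ χ̂_Δ exp Ĥ_J. (5.12) Let us first prove a lower
bound for (5.12); in this case C = ∅. We have [(5.12)] = ∫ P̄(dz_{Γ₁}) Π_{Δ∈Γ₁} χ̂_Δ exp H_{Γ₁} (Π_{□∩J≠∅} ∫ P̄(dz_□|z_{Γ₁}) Π_{Δ⊂□}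
χ̂_Δ exp Ψ_□) · (Π_{□∩J=∅} ∫ P̄(dz_□|z_{Γ₁}) Π_{Δ⊂□} χ̂_Δ) (5.13) where P̄(dz_{Γ₁}) denotes the probability distribution of the r.v.
(z_Δ)_{Δ⊂Γ₁} ≡ z_{Γ₁}, z_□ are the r.v. (z_Δ)_{Δ∈□}, P̄(dz_□|z_{Γ₁}) is their conditional probability for fixed z_{Γ₁} and the Markov
property of P̄ has been used."*

DICTIONARY (print ↦ Lean; every object is a DEFINITION with a body over p463705's carriers `Site d = ℤ^d`, `hamiltonian`, `Coef`).
* `H_R` (5.5) ↦ the tree's `hamiltonian s D ϰ a R` (sum over ordered tuples `Δ : Fin p → R`); the extension convention «A = 0 if some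
  Δ_i ⊄ J» ↦ the predicate `CoefSupportedIn a J` on the coefficient family (a hypothesis where needed, never baked into `a`).
* `H_{R,S}` (5.6) ↦ `interaction s D ϰ a R S := H_{R∪S} − H_R − H_S`.
* the tessera `□ ∈ Q^b` of side `L` (print: `L = b²`) with lower corner `m·L`, `m ∈ ℤ^d` ↦ `box L m = Π_i [m_iL, m_iL + L)`; the
  tessera containing `z` ↦ `boxIndex L z = (⌊z_i/L⌋)_i`; the box shrunk by `k` on every face ↦ `shrink L m k = Π_i [m_iL + k, m_iL + L − k)`,
  so that with the corridor width `w` (print: `w = b^{3/2}`): `Γ₁(□) = frame1 L w m = box ∖ shrink w`, `Γ₂(□) = frame2 L w m =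
  shrink w ∖ shrink 2w`, `□′ = core L w m = shrink 2w` — (5.7) is `box_eq_core_union_frame2_union_frame1` with pairwise disjointness.
* `Γ₁ = ⋃_□ Γ₁(□)` (5.8) ↦ `corridors L w B = ⋃_{m∈B} frame1 L w m` over a FINITE family `B` of boxes (print's union is over all of `Q^b`;
  in (5.9) only the boxes meeting the finite `J` carry terms, by the extension convention).
* `Ψ_□` (5.10) ↦ `psiBox … L w m = H_{shrink w} + H_{frame2, frame1}` (`□′ ∪ Γ₂(□) = shrink w`, `core_union_frame2`).
* `Ĥ_J`, `H^{(l)}` (5.9) ↦ `hatH … L w B = H_{corridors} + Σ_{m∈B} Ψ_□`, `Hl … J L w B = H_J − Ĥ_J` ((5.9) is then the identity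
  `hamiltonian_eq_hatH_add_Hl`; its CONTENT is the bound (5.11), not typed here).

WHAT IS PROVED (sorry-free, standard axioms): membership/partition lemmas for boxes and frames (`mem_box_iff`, `mem_shrink_iff`,
`shrink_subset_box`, `shrink_mono`, `core_union_frame2`, `box_eq_core_union_frame2_union_frame1`, the three disjointness lemmas,
`mem_box_boxIndex`, `boxIndex_eq_of_mem_box`, `disjoint_box`); ★ `shrink_enclosed` — `□′ ∪ Γ₂(□)` is `Γ`-enclosed (in the sense of
`B1Eq324BenfattoMarkov`) for every `Γ ⊇ Γ₁(□)`, `w ≥ 1`; `disjoint_corridors_shrink` (`Γ₁ ∩ (□′∪Γ₂(□)) = ∅`); ★★ `integral_P0_prod_boxes_eq`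
— (5.13) ON PRINT'S BOXES: for a finite family `B` of tesserae and observables `f_□` of the field in `□′ ∪ Γ₂(□)`, `∫ Π_{□∈B} f_□ dP̂₀ =
∫ [Π_□ ∫ f_□ dP̄_{z̄}] dP̂₀(z̄)` with `P̄ = condField d α β (corridors L w B)` (= `B1Eq324BenfattoDisintegration.integral_P0_prod_eq_…` with
its enclosure/disjointness hypotheses DISCHARGED by the box geometry).
HONEST SCOPE.  Objects and kernel bookkeeping only; the estimate (5.11) and everything after (5.13) are NOT here; print's side `b²` and
width `b^{3/2}` are kept as free naturals `L`, `w` (the arithmetic `b^{1/2}/4 ∈ ℕ` is print's simplification, not needed for these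
statements).  count-neutral for N08; `BasicLemmaPrinted` NOT discharged; nothing about d = 4, the continuum, OS axioms, a mass gap or Clay.
-/

noncomputable section

open Finset
open scoped BigOperators

namespace Literature.MathematicalPhysics.QuantumFieldTheory.Balaban1983to89.B1Eq324BenfattoSect5Boxes

open Literature.MathematicalPhysics.QuantumFieldTheory
open Literature.MathematicalPhysics.QuantumFieldTheory.Balaban1983to89.B3Sect3VectorSelfEnergy
open Literature.MathematicalPhysics.QuantumFieldTheory.Balaban1983to89.B3WT226FreeLattice
open Literature.MathematicalPhysics.QuantumFieldTheory.Balaban1983to89.B1Eq324BenfattoLemma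
open Literature.MathematicalPhysics.QuantumFieldTheory.Balaban1983to89.B1Eq324BenfattoMarkov
open Literature.MathematicalPhysics.QuantumFieldTheory.Balaban1983to89.B1Eq324BenfattoDisintegration

variable {d : ℕ}

/-! ## §1  (5.5)–(5.6): `H_R`, the extension convention, and the interaction `H_{R,S}` -/

/-- **The extension convention of (5.5)**: *"the definitions of the A's is extended so that A^{n₁…n_p}_{Δ₁…Δ_p} = 0 if some Δ_i ⊄ J"* —
as a predicate on a coefficient family `a : Coef d` (then `H_R = hamiltonian s D ϰ a R` for EVERY region `R`, the tree's `hamiltonian`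
summing over the tuples inside `R`). [cite: BenfattoEtAl1978, (5.5) p.154] -/
def CoefSupportedIn (a : Coef d) (J : Finset (ZSite d)) : Prop :=
  ∀ (p : ℕ) (Δ : Fin p → ZSite d) (n : Fin p → ℕ), (∃ i, Δ i ∉ J) → a p Δ n = 0

/-- **H_{R,S} (5.6)** — *"the interaction between R and S"*: `H_{R,S} = H_{R∪S} − H_R − H_S`. [cite: BenfattoEtAl1978, (5.6) p.154] -/
def interaction (s D : ℕ) (κ : ℝ) (a : Coef d) (R S : Finset (ZSite d)) (z : ZSite d → ℝ) : ℝ :=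
  hamiltonian s D κ a (R ∪ S) z - hamiltonian s D κ a R z - hamiltonian s D κ a S z

/-- The interaction is symmetric in the two regions. [cite: BenfattoEtAl1978, (5.6) p.154] -/
theorem interaction_comm (s D : ℕ) (κ : ℝ) (a : Coef d) (R S : Finset (ZSite d)) (z : ZSite d → ℝ) :
    interaction s D κ a R S z = interaction s D κ a S R z := by
  simp only [interaction, Finset.union_comm]
  ring

/-- No self-interaction: `H_{R,R} = −H_R` (so the interesting case is `R ≠ S`, print's «two different regions»).
[cite: BenfattoEtAl1978, (5.6) p.154] -/
theorem interaction_self (s D : ℕ) (κ : ℝ) (a : Coef d) (R : Finset (ZSite d)) (z : ZSite d → ℝ) :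
    interaction s D κ a R R z = -hamiltonian s D κ a R z := by
  simp only [interaction, Finset.union_idempotent]
  ring

/-! ## §2  (5.7): the tesserae `□` of side `L`, the corridors `Γ₁(□)`, `Γ₂(□)` of width `w`, the core `□′` -/

/-- **The tessera `□_m ∈ Q^b`** of side `L` (print: `L = b²`) with lower corner `m·L`: `Π_i [m_iL, m_iL + L) ∩ ℤ^d`.
[cite: BenfattoEtAl1978, (5.7) p.154] -/
def box (L : ℕ) (m : ZSite d) : Finset (ZSite d) :=
  Fintype.piFinset fun i => Finset.Ico (m i * (L : ℤ)) (m i * (L : ℤ) + L)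

/-- Membership in a tessera, coordinatewise. [cite: BenfattoEtAl1978, (5.7) p.154] -/
theorem mem_box_iff {L : ℕ} {m z : ZSite d} : z ∈ box L m ↔ ∀ i, m i * (L : ℤ) ≤ z i ∧ z i < m i * (L : ℤ) + L := by
  simp only [box, Fintype.mem_piFinset, Finset.mem_Ico]

/-- **The tessera shrunk by `k` on every face**: `Π_i [m_iL + k, m_iL + L − k)` — `k = 0` the tessera, `k = w` the region `□′ ∪ Γ₂(□)`
inside the outer corridor, `k = 2w` the core `□′`. [cite: BenfattoEtAl1978, (5.7) p.154] -/
def shrink (L : ℕ) (m : ZSite d) (k : ℕ) : Finset (ZSite d) :=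
  Fintype.piFinset fun i => Finset.Ico (m i * (L : ℤ) + k) (m i * (L : ℤ) + L - k)

/-- Membership in a shrunk tessera, coordinatewise. [cite: BenfattoEtAl1978, (5.7) p.154] -/
theorem mem_shrink_iff {L : ℕ} {m z : ZSite d} {k : ℕ} :
    z ∈ shrink L m k ↔ ∀ i, m i * (L : ℤ) + k ≤ z i ∧ z i < m i * (L : ℤ) + L - k := by
  simp only [shrink, Fintype.mem_piFinset, Finset.mem_Ico]

/-- `shrink L m 0 = box L m`. [cite: BenfattoEtAl1978, (5.7) p.154] -/
theorem shrink_zero (L : ℕ) (m : ZSite d) : shrink L m 0 = box L m := by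
  ext z
  simp only [mem_shrink_iff, mem_box_iff, Nat.cast_zero, add_zero, sub_zero]

/-- Shrinking more gives less. [cite: BenfattoEtAl1978, (5.7) p.154] -/
theorem shrink_mono (L : ℕ) (m : ZSite d) {k l : ℕ} (hkl : k ≤ l) : shrink L m l ⊆ shrink L m k := by
  intro z hz
  rw [mem_shrink_iff] at hz ⊢
  intro i
  have h := hz i
  have hkl' : (k : ℤ) ≤ l := by exact_mod_cast hkl
  constructor <;> linarith [h.1, h.2]

/-- A shrunk tessera lies in the tessera. [cite: BenfattoEtAl1978, (5.7) p.154] -/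
theorem shrink_subset_box (L : ℕ) (m : ZSite d) (k : ℕ) : shrink L m k ⊆ box L m := by
  rw [← shrink_zero]
  exact shrink_mono L m (Nat.zero_le k)

/-- **Γ₁(□)** — the outer corridor of width `w`, *"adjacent to the boundary of □"*: `□ ∖ shrink w`. [cite: BenfattoEtAl1978, (5.7) p.154] -/
def frame1 (L w : ℕ) (m : ZSite d) : Finset (ZSite d) :=
  box L m \ shrink L m w

/-- **Γ₂(□)** — the second corridor of width `w`, *"adjacent to the internal boundary of Γ₁(□)"*: `shrink w ∖ shrink 2w`.
[cite: BenfattoEtAl1978, (5.7) p.154] -/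
def frame2 (L w : ℕ) (m : ZSite d) : Finset (ZSite d) :=
  shrink L m w \ shrink L m (2 * w)

/-- **□′** — the core of the tessera: `shrink 2w`. [cite: BenfattoEtAl1978, (5.7) p.154] -/
def core (L w : ℕ) (m : ZSite d) : Finset (ZSite d) :=
  shrink L m (2 * w)

/-- `□′ ∪ Γ₂(□) = shrink w` (the region of the box variables integrated in (5.13) given `z_{Γ₁}`). [cite: BenfattoEtAl1978, (5.10) p.155] -/
theorem core_union_frame2 (L w : ℕ) (m : ZSite d) : core L w m ∪ frame2 L w m = shrink L m w := by
  rw [core, frame2, Finset.union_sdiff_of_subset (shrink_mono L m (Nat.le_mul_of_pos_left w two_pos))]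

/-- **(5.7): `□ = □′ ∪ Γ₂(□) ∪ Γ₁(□)`**. [cite: BenfattoEtAl1978, (5.7) p.154] -/
theorem box_eq_core_union_frame2_union_frame1 (L w : ℕ) (m : ZSite d) :
    box L m = core L w m ∪ frame2 L w m ∪ frame1 L w m := by
  rw [core_union_frame2, frame1, Finset.union_sdiff_of_subset (shrink_subset_box L m w)]

/-- The decomposition (5.7) is disjoint: `□′ ∩ Γ₂(□) = ∅`. [cite: BenfattoEtAl1978, (5.7) p.154] -/
theorem disjoint_core_frame2 (L w : ℕ) (m : ZSite d) : Disjoint (core L w m) (frame2 L w m) := by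
  rw [core, frame2]
  exact Finset.disjoint_sdiff

/-- The decomposition (5.7) is disjoint: `□′ ∩ Γ₁(□) = ∅`. [cite: BenfattoEtAl1978, (5.7) p.154] -/
theorem disjoint_core_frame1 (L w : ℕ) (m : ZSite d) : Disjoint (core L w m) (frame1 L w m) := by
  rw [core, frame1]
  exact Finset.disjoint_of_subset_left (shrink_mono L m (Nat.le_mul_of_pos_left w two_pos)) Finset.disjoint_sdiff

/-- The decomposition (5.7) is disjoint: `Γ₂(□) ∩ Γ₁(□) = ∅`. [cite: BenfattoEtAl1978, (5.7) p.154] -/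
theorem disjoint_frame2_frame1 (L w : ℕ) (m : ZSite d) : Disjoint (frame2 L w m) (frame1 L w m) := by
  rw [frame2, frame1]
  exact Finset.disjoint_of_subset_left Finset.sdiff_subset Finset.disjoint_sdiff

/-- `Γ₁(□)` misses `□′ ∪ Γ₂(□) = shrink w`. [cite: BenfattoEtAl1978, (5.7) p.154] -/
theorem disjoint_frame1_shrink (L w : ℕ) (m : ZSite d) : Disjoint (frame1 L w m) (shrink L m w) := by
  rw [frame1]
  exact Finset.sdiff_disjoint

/-- **The tessera containing a site**: `boxIndex L z = (⌊z_i/L⌋)_i` (Euclidean division; `L ≥ 1`). [cite: BenfattoEtAl1978, (5.7) p.154] -/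
def boxIndex (L : ℕ) (z : ZSite d) : ZSite d :=
  fun i => z i / (L : ℤ)

/-- **Every site lies in its tessera** (`L ≥ 1`): the pavement `Q^b` covers `ℤ^d`. [cite: BenfattoEtAl1978, (5.7) p.154] -/
theorem mem_box_boxIndex {L : ℕ} (hL : 0 < L) (z : ZSite d) : z ∈ box L (boxIndex L z) := by
  rw [mem_box_iff]
  intro i
  have hL' : (0 : ℤ) < L := by exact_mod_cast hL
  refine ⟨Int.ediv_mul_le (z i) hL'.ne', ?_⟩
  have h := Int.lt_ediv_add_one_mul_self (z i) hL'
  simp only [boxIndex]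
  linarith

/-- **Tesserae do not overlap**: a site of `□_m` has box index `m` (`L ≥ 1`). [cite: BenfattoEtAl1978, (5.7) p.154] -/
theorem boxIndex_eq_of_mem_box {L : ℕ} (hL : 0 < L) {m z : ZSite d} (hz : z ∈ box L m) : boxIndex L z = m := by
  rw [mem_box_iff] at hz
  funext i
  have hL' : (0 : ℤ) < L := by exact_mod_cast hL
  obtain ⟨h1, h2⟩ := hz i
  simp only [boxIndex]
  have hr0 : 0 ≤ z i - m i * (L : ℤ) := by linarith
  have hr1 : z i - m i * (L : ℤ) < L := by linarith
  have hz' : z i = (z i - m i * (L : ℤ)) + m i * (L : ℤ) := by ring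
  rw [hz', Int.add_mul_ediv_right _ _ hL'.ne', Int.ediv_eq_zero_of_lt hr0 hr1, zero_add]

/-- **Distinct tesserae are disjoint** (`L ≥ 1`). [cite: BenfattoEtAl1978, (5.7) p.154] -/
theorem disjoint_box {L : ℕ} (hL : 0 < L) {m m' : ZSite d} (hne : m ≠ m') : Disjoint (box L m) (box L m') := by
  rw [Finset.disjoint_left]
  intro z hz hz'
  exact hne ((boxIndex_eq_of_mem_box hL hz).symm.trans (boxIndex_eq_of_mem_box hL hz'))

/-- Distinct tesserae have disjoint shrunk regions. [cite: BenfattoEtAl1978, (5.7) p.154] -/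
theorem disjoint_shrink {L : ℕ} (hL : 0 < L) {m m' : ZSite d} (hne : m ≠ m') (k k' : ℕ) :
    Disjoint (shrink L m k) (shrink L m' k') :=
  Finset.disjoint_of_subset_left (shrink_subset_box L m k)
    (Finset.disjoint_of_subset_right (shrink_subset_box L m' k') (disjoint_box hL hne))

/-! ## §3  (5.8)–(5.10): the corridors `Γ₁`, `Ψ_□`, `Ĥ_J`, `H^{(l)}` -/

/-- **Γ₁ (5.8)** — `Γ₁ = ⋃_□ Γ₁(□)`, over a finite family `B` of tesserae (indices `m`). [cite: BenfattoEtAl1978, (5.8) p.155] -/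
def corridors (L w : ℕ) (B : Finset (ZSite d)) : Finset (ZSite d) :=
  B.biUnion fun m => frame1 L w m

/-- `Γ₁(□) ⊆ Γ₁` for `□ ∈ B`. [cite: BenfattoEtAl1978, (5.8) p.155] -/
theorem frame1_subset_corridors (L w : ℕ) {B : Finset (ZSite d)} {m : ZSite d} (hm : m ∈ B) :
    frame1 L w m ⊆ corridors L w B :=
  Finset.subset_biUnion_of_mem (fun m => frame1 L w m) hm

/-- **Γ₁ misses every `□′ ∪ Γ₂(□)`**, `□ ∈ B` (`L ≥ 1`): the box variables integrated in (5.13) are distinct from the conditioning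
variables `z_{Γ₁}`. [cite: BenfattoEtAl1978, (5.8) p.155, (5.13) p.155] -/
theorem disjoint_corridors_shrink {L : ℕ} (hL : 0 < L) (w : ℕ) (B : Finset (ZSite d)) (m : ZSite d) :
    Disjoint (corridors L w B) (shrink L m w) := by
  rw [corridors, Finset.disjoint_biUnion_left]
  intro m' _
  by_cases h : m' = m
  · rw [h]
    exact disjoint_frame1_shrink L w m
  · rw [frame1]
    exact Finset.disjoint_of_subset_left Finset.sdiff_subset
      (Finset.disjoint_of_subset_right (shrink_subset_box L m w) (disjoint_box hL h))

/-- **Ψ_□ (5.10)**: `Ψ_□ = H_{□′∪Γ₂(□)} + H_{Γ₂(□),Γ₁(□)}` (`□′ ∪ Γ₂(□) = shrink w`). [cite: BenfattoEtAl1978, (5.10) p.155] -/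
def psiBox (s D : ℕ) (κ : ℝ) (a : Coef d) (L w : ℕ) (m : ZSite d) (z : ZSite d → ℝ) : ℝ :=
  hamiltonian s D κ a (shrink L m w) z + interaction s D κ a (frame2 L w m) (frame1 L w m) z

/-- **Ĥ_J (5.9)**: `Ĥ_J = H_{Γ₁} + Σ_{□} Ψ_□` over the finite family `B` of tesserae (print: the `□` with `□ ∩ J ≠ ∅`).
[cite: BenfattoEtAl1978, (5.9) p.155] -/
def hatH (s D : ℕ) (κ : ℝ) (a : Coef d) (L w : ℕ) (B : Finset (ZSite d)) (z : ZSite d → ℝ) : ℝ :=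
  hamiltonian s D κ a (corridors L w B) z + ∑ m ∈ B, psiBox s D κ a L w m z

/-- **H^{(l)} (5.9)**: `H^{(l)} = H_J − Ĥ_J` — the terms of `H_J` reaching across a corridor (bounded in (5.11) by the decay
`e^{−(ϰ/4)b^{3/2}}`; the bound is not typed here). [cite: BenfattoEtAl1978, (5.9) p.155] -/
def Hl (s D : ℕ) (κ : ℝ) (a : Coef d) (J : Finset (ZSite d)) (L w : ℕ) (B : Finset (ZSite d)) (z : ZSite d → ℝ) : ℝ :=
  hamiltonian s D κ a J z - hatH s D κ a L w B z

/-- **(5.9) as an identity**: `H_J = Ĥ_J + H^{(l)}`. [cite: BenfattoEtAl1978, (5.9) p.155] -/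
theorem hamiltonian_eq_hatH_add_Hl (s D : ℕ) (κ : ℝ) (a : Coef d) (J : Finset (ZSite d)) (L w : ℕ) (B : Finset (ZSite d))
    (z : ZSite d → ℝ) : hamiltonian s D κ a J z = hatH s D κ a L w B z + Hl s D κ a J L w B z := by
  rw [Hl]
  ring

/-! ## §4  The instance of (5.13) on print's boxes: `□′ ∪ Γ₂(□)` is enclosed by `Γ₁(□)`, and the factorisation -/

/-- The shrunk tessera as a set is a lattice box `{z | ∀ i, a_i ≤ z_i ≤ b_i}`. [cite: BenfattoEtAl1978, (5.7) p.154] -/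
theorem coe_shrink_eq (L : ℕ) (m : ZSite d) (k : ℕ) :
    ((shrink L m k : Finset (ZSite d)) : Set (ZSite d)) =
      {z : ZSite d | ∀ i, m i * (L : ℤ) + k ≤ z i ∧ z i ≤ m i * (L : ℤ) + L - k - 1} := by
  ext z
  simp only [Finset.mem_coe, mem_shrink_iff, Set.mem_setOf_eq]
  refine forall_congr' fun i => ?_
  constructor
  · rintro ⟨h1, h2⟩
    exact ⟨h1, by omega⟩
  · rintro ⟨h1, h2⟩
    exact ⟨h1, by omega⟩

/-- **`□′ ∪ Γ₂(□) = shrink w` IS ENCLOSED BY ITS CORRIDOR**: for `w ≥ 1` and any `Γ ⊇ Γ₁(□)`, every lattice neighbour of a site of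
`shrink w` lies in `shrink w` or in `Γ` — the hypothesis of the Markov / factorisation theorems of `B1Eq324BenfattoMarkov` /
`B1Eq324BenfattoDisintegration`, discharged for print's geometry (the unit collar of `shrink w` lies in `□ ∖ shrink w = Γ₁(□)`).
[cite: BenfattoEtAl1978, (5.7) p.154, (5.13) p.155] -/
theorem shrink_enclosed {L w : ℕ} (hw : 1 ≤ w) (m : ZSite d) {Γ : Finset (ZSite d)} (hΓ : frame1 L w m ⊆ Γ) :
    ∀ z ∈ ((shrink L m w : Finset (ZSite d)) : Set (ZSite d)), ∀ μ : Fin d,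
      (z + unitVec μ ∈ ((shrink L m w : Finset (ZSite d)) : Set (ZSite d)) ∨ z + unitVec μ ∈ Γ) ∧
      (z - unitVec μ ∈ ((shrink L m w : Finset (ZSite d)) : Set (ZSite d)) ∨ z - unitVec μ ∈ Γ) := by
  rw [coe_shrink_eq]
  refine box_enclosed_of_collar_subset (fun i => m i * (L : ℤ) + w) (fun i => m i * (L : ℤ) + L - w - 1) fun z hnot hcol => ?_
  apply hΓ
  rw [frame1, Finset.mem_sdiff, mem_box_iff, mem_shrink_iff]
  have hw' : (1 : ℤ) ≤ w := by exact_mod_cast hw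
  refine ⟨fun i => ?_, fun h => hnot fun i => ?_⟩
  · obtain ⟨h1, h2⟩ := hcol i
    constructor <;> linarith
  · obtain ⟨h1, h2⟩ := h i
    exact ⟨h1, by linarith⟩

/-- **(5.13) ON PRINT'S BOXES — conditioning on the corridors `Γ₁ = ⋃_{□∈B} Γ₁(□)` factorizes the integral over the box regions
`□′ ∪ Γ₂(□)`**: for a finite family `B` of tesserae (side `L ≥ 1`, corridor width `w ≥ 1`), measurable observables `f_□` of the field in
`□′ ∪ Γ₂(□)` with `Π_□ f_□` integrable, and `P̄_{z̄} = condField d α β Γ₁ z̄`: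
`∫ Π_{□∈B} f_□(z|_{□′∪Γ₂(□)}) dP̂₀(z) = ∫ [Π_{□∈B} ∫ f_□ dP̄_{z̄}] dP̂₀(z̄)` — print's *"P̄(dz_□|z_{Γ₁}) is their conditional probability for
fixed z_{Γ₁} and the Markov property of P̄ has been used"*, with every geometric hypothesis of
`B1Eq324BenfattoDisintegration.integral_P0_prod_eq_integral_prod_condField` DISCHARGED: the regions are pairwise disjoint
(`disjoint_shrink`), miss `Γ₁` (`disjoint_corridors_shrink`) and are enclosed by it (`shrink_enclosed`).
[cite: BenfattoEtAl1978, §5 (5.13) p.155] -/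
theorem integral_P0_prod_boxes_eq {α β : ℝ} (hα : 0 < α) (hβ : 0 < β) {L w : ℕ} (hL : 0 < L) (hw : 1 ≤ w)
    (B : Finset (ZSite d))
    (f : (m : B) → ((((shrink L (m : ZSite d) w : Finset (ZSite d)) : Set (ZSite d))) → ℝ) → ℝ)
    (hf : ∀ m, Measurable (f m))
    (hint : MeasureTheory.Integrable
      (fun z : ZSite d → ℝ => ∏ m : B, f m (fun s : ((shrink L (m : ZSite d) w : Finset (ZSite d)) : Set (ZSite d)) => z s))
      (P0 d α β)) :
    ∫ z, ∏ m : B, f m (fun s : ((shrink L (m : ZSite d) w : Finset (ZSite d)) : Set (ZSite d)) => z s) ∂P0 d α β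
      = ∫ zbar, ∏ m : B, (∫ z, f m (fun s : ((shrink L (m : ZSite d) w : Finset (ZSite d)) : Set (ZSite d)) => z s)
          ∂condField d α β (corridors L w B) zbar) ∂P0 d α β := by
  refine integral_P0_prod_eq_integral_prod_condField hα hβ (corridors L w B)
    (Ω := fun m : B => ((shrink L (m : ZSite d) w : Finset (ZSite d)) : Set (ZSite d))) ?_ ?_ ?_ f hf hint
  · intro m z hz hzΓ
    rw [Finset.mem_coe] at hz
    exact Finset.disjoint_left.mp (disjoint_corridors_shrink hL w B (m : ZSite d)) hzΓ hz
  · intro m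
    exact shrink_enclosed hw (m : ZSite d) (frame1_subset_corridors L w m.2)
  · intro m m' hne
    rw [Finset.disjoint_coe]
    exact disjoint_shrink hL (fun h => hne (Subtype.ext h)) w w

end Literature.MathematicalPhysics.QuantumFieldTheory.Balaban1983to89.B1Eq324BenfattoSect5Boxes

end
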